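import Mathlib
import HarnessLib

/-!
# The all-or-nothing root lemma: polynomial core (Sahi programme, prover prim-sahi-p2 gen 36)

Support file (`--supports stmt-CriticalPhenomena-4575`); no definitions, no named facts, no sorries; standard axioms.  Memo
`run/shared/lean/prim/prim-sahi/FROM-prim-sahi-p2-gen36-ALL-OR-NOTHING.md` §2, `prim-sahi-p2/PROOF-E3.md` §46.

Setting (memo §2).  Root `s`, targets `i ≠ j`, direct gates `a = w(s,i)`, `b = w(s,j)`, `H = G − s` ARBITRARY, and `N'` the set of the other
neighbours of `s`.  Compare the two pinned laws: `P¹` = every pair `s–N'` open, `P⁰` = every pair `s–N'` closed (a two-pronged root).  With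
`K = C_H(N')` (the union of the `H`-clusters of `N'`) and the increasing `H`-events `I = {i ∈ K}`, `J = {j ∈ K}`, `U = {i ↔_H j}` (note
`I ∩ U ⊆ J`, `J ∩ U ⊆ I`), the `H`-configuration splits into six atoms `n₀ = P(¬I¬J¬U)`, `ν = P(¬I¬J U)`, `x = P(I¬J)`, `y = P(¬I J)`,
`z = P(I J ¬U)`, `t = P(I J U)`, and the connection probabilities are
`A¹ = P¹(s↔i) = a n₀ + (a+b−ab)ν + x + a y + z + t`, `B¹ = b n₀ + (a+b−ab)ν + b x + y + z + t`, `D¹ = P¹(s↔i, s↔j) = ab n₀ + (a+b−ab)ν + b x + a y + z + t`,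
`A⁰ = a + (1−a)b(ν+t)`, `B⁰ = b + (1−b)a(ν+t)`, `D⁰ = ab + (a+b−2ab)(ν+t)`.
**`allOrNothing_core`**: Harris' inequality for the pairs `(I, J ∪ U)` and `(J, I ∪ U)` — `(x+z+t)(ν+y+z+t) ≤ z+t`, `(y+z+t)(ν+x+z+t) ≤ z+t` —
implies `2(D¹ − D⁰) − A¹(B¹ − B⁰) − B¹(A¹ − A⁰) ≥ 0`, by an explicit identity: the left side equals
`θB·slack_I + (1−θ)B·slack_J + Σ_m r_m(a,b)·m` with `θ = (1+a²−b²)/2`, `B = (1−a)(1−b)(2−a−b)` and sixteen quadratic monomials `m` in the atoms with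
coefficients `r_m ≥ 0` on `[0,1]²` (`allOrNothing_rx_nonneg` is the one needing a Bernstein certificate).  The measure-level theorem
(memo §2: for EVERY finite weighted graph, `2(q¹_ij − q⁰_ij) ≥ q¹_i(q¹_j − q⁰_j) + q¹_j(q¹_i − q⁰_i)`; the one-relay Lemma R1 `oneRelay_R1_core` and the
relay-cloud inequality TOP* are special cases) is assembled from this core by conditioning on the `H`-configuration.
-/

noncomputable section

namespace Summit.CriticalPhenomena.PercolationContinuityZ3.Theorems

namespace IncStar

/-- The residual coefficient `r(a,b) = b + ab − a + (1 + a² − b²)(1−b)(2−a−b)/2` of the all-or-nothing certificate is nonnegative on `[0,1]²`: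
all its tensor-Bernstein coefficients of bidegree `(3,4)` are `≥ 0` (18 nonzero). [this work] -/
theorem allOrNothing_rx_nonneg (a b : ℝ) (ha : 0 ≤ a) (ha' : a ≤ 1) (hb : 0 ≤ b) (hb' : b ≤ 1) :
    0 ≤ b + a * b - a + (1 + a * a - b * b) * (1 - b) * (2 - a - b) / 2 := by
  have h1a : 0 ≤ 1 - a := sub_nonneg.2 ha'
  have h1b : 0 ≤ 1 - b := sub_nonneg.2 hb'
  have key : b + a * b - a + (1 + a * a - b * b) * (1 - b) * (2 - a - b) / 2
      = (1 : ℝ) * (1 - a) * (1 - a) * (1 - a) * (1 - b) * (1 - b) * (1 - b) * (1 - b)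
      + ((7 : ℝ) / 2) * (1 - a) * (1 - a) * (1 - a) * b * (1 - b) * (1 - b) * (1 - b)
      + (4 : ℝ) * (1 - a) * (1 - a) * (1 - a) * b * b * (1 - b) * (1 - b)
      + (3 : ℝ) * (1 - a) * (1 - a) * (1 - a) * b * b * b * (1 - b)
      + (1 : ℝ) * (1 - a) * (1 - a) * (1 - a) * b * b * b * b
      + ((3 : ℝ) / 2) * a * (1 - a) * (1 - a) * (1 - b) * (1 - b) * (1 - b) * (1 - b)
      + (6 : ℝ) * a * (1 - a) * (1 - a) * b * (1 - b) * (1 - b) * (1 - b)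
      + (8 : ℝ) * a * (1 - a) * (1 - a) * b * b * (1 - b) * (1 - b)
      + (8 : ℝ) * a * (1 - a) * (1 - a) * b * b * b * (1 - b)
      + (3 : ℝ) * a * (1 - a) * (1 - a) * b * b * b * b
      + (1 : ℝ) * a * a * (1 - a) * (1 - b) * (1 - b) * (1 - b) * (1 - b)
      + (4 : ℝ) * a * a * (1 - a) * b * (1 - b) * (1 - b) * (1 - b)
      + (6 : ℝ) * a * a * (1 - a) * b * b * (1 - b) * (1 - b)
      + ((15 : ℝ) / 2) * a * a * (1 - a) * b * b * b * (1 - b)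
      + (3 : ℝ) * a * a * (1 - a) * b * b * b * b
      + ((1 : ℝ) / 2) * a * a * a * b * b * (1 - b) * (1 - b)
      + (2 : ℝ) * a * a * a * b * b * b * (1 - b)
      + (1 : ℝ) * a * a * a * b * b * b * b := by ring
  rw [key]
  positivity

/-- **ALL-OR-NOTHING ROOT LEMMA, polynomial core.**  See the module docstring for the meaning of the variables: `a, b ∈ [0,1]` are the direct
gates, `(n₀, ν, x, y, z, t)` a probability vector (the six atoms of `(I, J, U)`, with `n₀ = 1 − ν − x − y − z − t` eliminated), `hI`, `hJ` the two
Harris inequalities.  Conclusion: `0 ≤ 2(D¹ − D⁰) − A¹(B¹ − B⁰) − B¹(A¹ − A⁰)`. [this work] -/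
theorem allOrNothing_core (a b nu x y z t A1 B1 D1 A0 B0 D0 : ℝ)
    (ha : 0 ≤ a) (ha' : a ≤ 1) (hb : 0 ≤ b) (hb' : b ≤ 1)
    (hnu : 0 ≤ nu) (hx : 0 ≤ x) (hy : 0 ≤ y) (hz : 0 ≤ z) (ht : 0 ≤ t) (hn0 : 0 ≤ 1 - nu - x - y - z - t)
    (hI : (x + z + t) * (nu + y + z + t) ≤ z + t) (hJ : (y + z + t) * (nu + x + z + t) ≤ z + t)
    (hA1 : A1 = a * (1 - nu - x - y - z - t) + (a + b - a * b) * nu + x + a * y + z + t)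
    (hB1 : B1 = b * (1 - nu - x - y - z - t) + (a + b - a * b) * nu + b * x + y + z + t)
    (hD1 : D1 = a * b * (1 - nu - x - y - z - t) + (a + b - a * b) * nu + b * x + a * y + z + t)
    (hA0 : A0 = a + (1 - a) * b * (nu + t)) (hB0 : B0 = b + (1 - b) * a * (nu + t)) (hD0 : D0 = a * b + (a + b - 2 * a * b) * (nu + t)) :
    0 ≤ 2 * (D1 - D0) - A1 * (B1 - B0) - B1 * (A1 - A0) := by
  subst hA1 hB1 hD1 hA0 hB0 hD0
  have h1a : 0 ≤ 1 - a := sub_nonneg.2 ha'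
  have h1b : 0 ≤ 1 - b := sub_nonneg.2 hb'
  have h2ab : 0 ≤ 2 - a - b := by linarith
  have hab1 : 0 ≤ a + b - a * b := by nlinarith
  have hab2 : 0 ≤ a + b - 2 * a * b := by nlinarith
  have hab3 : 0 ≤ 2 * b + a - 3 * a * b := by nlinarith
  have hab4 : 0 ≤ 2 * a + b - 3 * a * b := by nlinarith
  have hth : 0 ≤ 1 + a * a - b * b := by nlinarith
  have hth' : 0 ≤ 1 - a * a + b * b := by nlinarith
  have hrx : 0 ≤ (b + a * b - a + (1 + a * a - b * b) * (1 - b) * (2 - a - b) / 2) := allOrNothing_rx_nonneg a b ha ha' hb hb'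
  have hry : 0 ≤ (a + a * b - b + (1 + b * b - a * a) * (1 - a) * (2 - a - b) / 2) := by
    have := allOrNothing_rx_nonneg b a hb hb' ha ha'
    have e : a + a * b - b + (1 + b * b - a * a) * (1 - a) * (2 - a - b) / 2
        = a + b * a - b + (1 + b * b - a * a) * (1 - a) * (2 - b - a) / 2 := by ring
    rw [e]; exact this
  have hsI : 0 ≤ z + t - (x + z + t) * (nu + y + z + t) := sub_nonneg.2 hI
  have hsJ : 0 ≤ z + t - (y + z + t) * (nu + x + z + t) := sub_nonneg.2 hJ
  have key : 2 * ((a * b * (1 - nu - x - y - z - t) + (a + b - a * b) * nu + b * x + a * y + z + t) - (a * b + (a + b - 2 * a * b) * (nu + t))) - (a * (1 - nu - x - y - z - t) + (a + b - a * b) * nu + x + a * y + z + t) * ((b * (1 - nu - x - y - z - t) + (a + b - a * b) * nu + b * x + y + z + t) - (b + (1 - b) * a * (nu + t))) - (b * (1 - nu - x - y - z - t) + (a + b - a * b) * nu + b * x + y + z + t) * ((a * (1 - nu - x - y - z - t) + (a + b - a * b) * nu + x + a * y + z + t) - (a + (1 - a) * b * (nu + t)))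
      = ((1 + a * a - b * b) / 2) * ((1 - a) * (1 - b) * (2 - a - b)) * (z + t - (x + z + t) * (nu + y + z + t))
      + ((1 - a * a + b * b) / 2) * ((1 - a) * (1 - b) * (2 - a - b)) * (z + t - (y + z + t) * (nu + x + z + t))
      + b * (1 - a) * ((1 - nu - x - y - z - t) * x)
      + a * (1 - b) * ((1 - nu - x - y - z - t) * y)
      + (2 - a - b) * (a + b - a * b) * ((1 - nu - x - y - z - t) * z)
      + (1 - a) * (b + a * b - a + (1 + a * a - b * b) * (1 - b) * (2 - a - b) / 2) * (nu * x)
      + (1 - b) * (a + a * b - b + (1 + b * b - a * a) * (1 - a) * (2 - a - b) / 2) * (nu * y)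
      + ((1 - a) * (1 - b) * (2 - a - b) + (a + b - 2 * a * b)) * (nu * z)
      + 2 * (1 - a) * (1 - a) * (1 - b) * (1 - b) * (nu * t)
      + b * (1 - a) * (x * x)
      + (b * b * (1 - a) + a * a * (1 - b)) * (x * y)
      + (2 * b + a - 3 * a * b) * (x * z)
      + b * b * (1 - a) * (x * t)
      + a * (1 - b) * (y * y)
      + (2 * a + b - 3 * a * b) * (y * z)
      + a * a * (1 - b) * (y * t)
      + (a + b - 2 * a * b) * (z * z)
      + (a + b - 2 * a * b) * (z * t) := by ring
  rw [key]
  positivity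

end IncStar

end Summit.CriticalPhenomena.PercolationContinuityZ3.Theorems
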